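import Summits.AtomisticToContinuum.Crystallization.Theorems.ReggeStarCoercivityDefectFreeCrystallizesGoodLaw01
import Summits.AtomisticToContinuum.Crystallization.Theorems.ReggeStarCoercivityDefectFreeCrystallizesGoodLaw02
import Summits.AtomisticToContinuum.Crystallization.Theorems.PalmUnimodularRigidityBenjaminiSchrammLimit

/-!
# `stub_goodLaw : GoodLawOfZeroDefects` — P1 of line `palm-good-law` (crux stmt-AtomisticToContinuum-13603, `ReggeStarCoercivity.DefectFreeCrystallizes`)

**Statement** (`PalmGoodLaw.GoodLawOfZeroDefects`). For every sequence `x` of Lennard-Jones ground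
states along which the defect fraction `defects (x N) / N` tends to `0`, some Benjamini–Schramm limit
law `(φ, δ, P)` — the clauses of the PROVED item 9230 `BenjaminiSchrammLimit` verbatim — is almost
surely carried by configurations `count|S` ALL of whose points are `SetGood S y` (the crux's `Good`,
read on an infinite configuration with the OPEN outer cutoff `6/5`).

**Proof.** Take `(φ, δ, P)` from `benjaminiSchrammLimit_proof`; the first seven clauses are its. For the
last clause:

1. *Bad events are null* (part 2, `measure_setOf_eq_zero_of_good`). For a level `0 < η ≤ 1/50` call a
   configuration `ν` root-good at level `η` if its points `p ≠ 0` with `‖p‖ < 6/5 - η` are, after a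
   scale `a ∈ [9/10, 11/10]` and a linear isometry, `(1/20 + η)`-matched to the fcc or the hcp kissing
   pattern. By the finite-`N` geometric lemma (part 1, `exists_bijOn_of_good_matched`) a `Good` particle
   whose recentred configuration is `(2, ε)`-matched (`ε = min (η/4, δ₀/4, δ/4)`, `δ₀` the uniform
   minimal distance of ground states) to a rooted `δ`-hard-core `ν` forces `ν` to be root-good at level
   `η`. So if the event "not root-good at level `η`" had positive probability, the density-transfer
   clause of 9230 would produce eventually `≥ ρ φ(j)` defective particles, against `defects / N → 0`.
2. *`η ↓ 0`* (part 2, `exists_bijOn_limit`). Almost surely `ν = count|S` is root-good at every level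
   `η n = (1/50)/(n+1)`; the punctured open balls of radii `6/5 - η n` stabilise (a separated set is
   locally finite), one of the two patterns and one of the finitely many bijections occur infinitely
   often, and compactness of `[9/10, 11/10] × O(3)` gives an exact `1/20`-matching of the punctured open
   ball of radius `6/5`: `SetGood S 0`.
3. *Every point* (`PalmUnimodularRigidity.ae_forall_map_sub_of_ae`, the Aldous–Lyons "everything shows
   at the root" lemma for point-stationary laws, PROVED in item 9228's file): almost surely the
   configuration re-rooted at each of its points `y` is root-good, and re-rooting `count|S` at `y` is
   `count|(S - y)` (`map_sub_count_restrict`), whose root-goodness is `SetGood S y`.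
-/

noncomputable section

open Filter Topology MeasureTheory

namespace Summit.AtomisticToContinuum.Crystallization.Theorems.PalmGoodLaw

open Summit.AtomisticToContinuum.Crystallization.Theorems.DefectFreeCrystallizes.Negative.PredicateAPI
open Literature.MathematicalPhysics.StatisticalMechanics Literature.Geometry.DiscreteGeometry
open Literature.Probability.Process

/-! ### Bookkeeping: translation, counting measures, from bijections to `SetGood` -/

/-- Root-goodness of the translate `S - y` is goodness of `y` in `S`. -/
theorem setGood_of_setGood_image_sub {S : Set (EuclideanSpace ℝ (Fin 3))} {y : EuclideanSpace ℝ (Fin 3)}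
    (h : SetGood ((fun z : EuclideanSpace ℝ (Fin 3) => z - y) '' S) 0) : SetGood S y := by
  obtain ⟨a, ha₁, ha₂, T, hT, hsh⟩ := h
  refine ⟨a, ha₁, ha₂, T, ?_, hsh⟩
  rw [hT]
  ext t
  simp only [Set.mem_image, Set.mem_setOf_eq, sub_zero, dist_zero_right]
  constructor
  · rintro ⟨z, ⟨⟨w, hw, rfl⟩, hne, hlt⟩, rfl⟩
    exact ⟨w, ⟨hw, fun h => hne (by rw [h, sub_self]), by rwa [dist_eq_norm]⟩, rfl⟩
  · rintro ⟨w, ⟨hw, hne, hlt⟩, rfl⟩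
    exact ⟨w - y, ⟨⟨w, hw, rfl⟩, sub_ne_zero.2 hne, by rwa [← dist_eq_norm]⟩, rfl⟩

/-- A set is determined by its counting measure. -/
theorem eq_of_count_restrict_eq {S S' : Set (EuclideanSpace ℝ (Fin 3))}
    (h : (Measure.count : Measure (EuclideanSpace ℝ (Fin 3))).restrict S =
      (Measure.count : Measure (EuclideanSpace ℝ (Fin 3))).restrict S') : S = S' := by
  ext p
  rw [← count_restrict_singleton_ne_zero_iff S p, h, count_restrict_singleton_ne_zero_iff]

/-- From an exact `1/20`-matching (as a bijection from the pattern) of the punctured open ball of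
radius `6/5` of `S` to `SetGood S 0`. -/
theorem setGood_zero_of_bijOn {S : Set (EuclideanSpace ℝ (Fin 3))}
    {Pat : Finset (EuclideanSpace ℝ (Fin 3))}
    (hPat : Pat = fccKissingPattern ∨ Pat = hcpKissingPattern) {a : ℝ} (ha₁ : 9 / 10 ≤ a)
    (ha₂ : a ≤ 11 / 10) {A : EuclideanSpace ℝ (Fin 3) →ₗᵢ[ℝ] EuclideanSpace ℝ (Fin 3)}
    {f : EuclideanSpace ℝ (Fin 3) → EuclideanSpace ℝ (Fin 3)}
    (hf : Set.BijOn f (↑Pat : Set (EuclideanSpace ℝ (Fin 3)))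
      {p : EuclideanSpace ℝ (Fin 3) | p ∈ S ∧ p ≠ 0 ∧ ‖p‖ < 6 / 5})
    (hd : ∀ v ∈ Pat, dist (a⁻¹ • f v) (A v) ≤ 1 / 20) : SetGood S 0 := by
  have ha : 0 < a := by linarith
  have hinj : Set.InjOn (fun v => a⁻¹ • f v) (↑Pat : Set (EuclideanSpace ℝ (Fin 3))) :=
    fun v hv w hw hvw => hf.injOn hv hw (smul_right_injective _ (inv_ne_zero ha.ne') hvw)
  have hinjA : Set.InjOn A (↑Pat : Set (EuclideanSpace ℝ (Fin 3))) := fun v _ w _ hvw => A.injective hvw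
  have hm : EtaMatched (1 / 20) (Pat.image fun v => a⁻¹ • f v) (Pat.image A) :=
    etaMatched_image_of_injOn hinj hinjA hd
  refine ⟨a, ha₁, ha₂, Pat.image fun v => a⁻¹ • f v, ?_, ?_⟩
  · rw [Finset.coe_image]
    ext t
    simp only [Set.mem_image, Finset.mem_coe, Set.mem_setOf_eq, sub_zero, dist_zero_right]
    constructor
    · rintro ⟨v, hv, rfl⟩
      exact ⟨f v, hf.mapsTo (Finset.mem_coe.2 hv), rfl⟩
    · rintro ⟨z, hz, rfl⟩
      obtain ⟨v, hv, rfl⟩ := hf.surjOn hz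
      exact ⟨v, Finset.mem_coe.1 hv, rfl⟩
  · rcases hPat with rfl | rfl
    · exact Or.inl ⟨A, hm⟩
    · exact Or.inr ⟨A, hm⟩

/-! ### The theorem -/

/-- **P1 `GoodLawOfZeroDefects` (stub `stub_goodLaw` of line `palm-good-law`, crux
stmt-AtomisticToContinuum-13603).** Along every sequence of Lennard-Jones ground states with defect
fraction `→ 0`, the Benjamini–Schramm limit law of item 9230 is almost surely carried by configurations
all of whose points are `SetGood`. See the module docstring for the proof. -/
theorem stub_goodLaw : GoodLawOfZeroDefects := by
  intro x hx hZ
  obtain ⟨φ, hφ, δ, hδ, P, hP, hcore, hstat, hE, htr⟩ := benjaminiSchrammLimit_proof x hx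
  have hcore' : ∀ᵐ μ ∂P, IsRootedHardCore δ μ := hcore
  haveI := hP
  refine ⟨φ, δ, P, hφ, hδ, hP, hcore', hstat, hE, htr, ?_⟩
  -- uniform separation of the ground states
  obtain ⟨δ₀, hδ₀, hsepx⟩ := LennardJonesMinimalDistance_holds
  -- levels `η n ↓ 0` and matching tolerances `ε n`
  set η : ℕ → ℝ := fun n => 1 / 50 * (1 / ((n : ℝ) + 1))
  have hηpos : ∀ n, 0 < η n := fun n => by
    show 0 < 1 / 50 * (1 / ((n : ℝ) + 1))
    positivity
  have hηle : ∀ n, η n ≤ 1 / 50 := fun n => by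
    show 1 / 50 * (1 / ((n : ℝ) + 1)) ≤ 1 / 50
    have h1 : 1 / ((n : ℝ) + 1) ≤ 1 := by
      rw [div_le_one (by positivity)]
      linarith [(n.cast_nonneg : (0 : ℝ) ≤ n)]
    linarith
  have hηlim : Tendsto η atTop (𝓝 0) := by
    have := (tendsto_one_div_add_atTop_nhds_zero_nat (𝕜 := ℝ)).const_mul (1 / 50 : ℝ)
    rw [mul_zero] at this
    exact this
  set ε : ℕ → ℝ := fun n => min (η n / 4) (min δ₀ δ / 4)
  have hεpos : ∀ n, 0 < ε n := fun n =>
    lt_min (by linarith [hηpos n]) (div_pos (lt_min hδ₀ hδ) four_pos)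
  have hεη : ∀ n, ε n ≤ η n / 4 := fun n => min_le_left _ _
  have hεδ₀ : ∀ n, 2 * ε n < δ₀ := fun n => by
    have h1 : ε n ≤ min δ₀ δ / 4 := min_le_right _ _
    have h2 : min δ₀ δ ≤ δ₀ := min_le_left _ _
    linarith
  have hεδ : ∀ n, 2 * ε n < δ := fun n => by
    have h1 : ε n ≤ min δ₀ δ / 4 := min_le_right _ _
    have h2 : min δ₀ δ ≤ δ := min_le_right _ _
    linarith
  -- root-goodness of `ν` at level `η n` for the pattern `Pat`, as a bijection from the pattern
  set GR : Finset (EuclideanSpace ℝ (Fin 3)) → ℕ → Measure (EuclideanSpace ℝ (Fin 3)) → Prop :=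
    fun Pat n ν => ∃ a : ℝ, 9 / 10 ≤ a ∧ a ≤ 11 / 10 ∧
      ∃ A : EuclideanSpace ℝ (Fin 3) →ₗᵢ[ℝ] EuclideanSpace ℝ (Fin 3),
      ∃ f : EuclideanSpace ℝ (Fin 3) → EuclideanSpace ℝ (Fin 3),
        Set.BijOn f (↑Pat : Set (EuclideanSpace ℝ (Fin 3)))
          {p : EuclideanSpace ℝ (Fin 3) | ν {p} ≠ 0 ∧ p ≠ 0 ∧ ‖p‖ < 6 / 5 - η n} ∧
        ∀ v ∈ Pat, dist (a⁻¹ • f v) (A v) ≤ 1 / 20 + η n with hGR_def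
  -- Step 1: at each level, "not root-good" is a null event
  have hnull : ∀ n, P {ν | ¬ (GR fccKissingPattern n ν ∨ GR hcpKissingPattern n ν)} = 0 := by
    intro n
    refine measure_setOf_eq_zero_of_good hφ hcore' htr hZ (R := 2) (hεpos n)
      (Bad := fun ν => ¬ (GR fccKissingPattern n ν ∨ GR hcpKissingPattern n ν)) ?_
    intro N i ν hhc hbad hgood hM1 hM2
    obtain ⟨S', h0, hsep, rfl⟩ := hhc
    apply hbad
    simp only [hGR_def, count_restrict_singleton_ne_zero_iff] at hM1 hM2 ⊢
    have hM1' : ∀ p ∈ S', ‖p‖ ≤ 2 → ∃ k, dist (x N k - x N i) p ≤ ε n := fun p hp hpn => by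
      obtain ⟨q, ⟨k, rfl⟩, hq⟩ := hM1 p hp hpn
      exact ⟨k, hq⟩
    have hM2' : ∀ k, ‖x N k - x N i‖ ≤ 2 → ∃ p ∈ S', dist (x N k - x N i) p ≤ ε n := fun k hk =>
      hM2 _ ⟨k, rfl⟩ hk
    obtain ⟨a, ha₁, ha₂, hor⟩ := hgood
    rcases hor with ⟨A, hm⟩ | ⟨A, hm⟩
    · left
      obtain ⟨f, hf, hd⟩ := exists_bijOn_of_good_matched (hsepx N (x N) (hx N)) h0 hsep (hεpos n).le
        (hεη n) (hηle n) (hεδ₀ n) (hεδ n) hM1' hM2' ha₁ ha₂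
        (fun v hv => norm_eq_one_of_mem_fccKissingPattern hv) hm
      exact ⟨a, ha₁, ha₂, A, f, hf, hd⟩
    · right
      obtain ⟨f, hf, hd⟩ := exists_bijOn_of_good_matched (hsepx N (x N) (hx N)) h0 hsep (hεpos n).le
        (hεη n) (hηle n) (hεδ₀ n) (hεδ n) hM1' hM2' ha₁ ha₂
        (fun v hv => norm_eq_one_of_mem_hcpKissingPattern hv) hm
      exact ⟨a, ha₁, ha₂, A, f, hf, hd⟩
  have hall : ∀ᵐ ν ∂P, ∀ n, GR fccKissingPattern n ν ∨ GR hcpKissingPattern n ν :=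
    ae_all_iff.2 fun n => ae_iff.2 (hnull n)
  -- Step 2: almost surely the root is `SetGood`
  have hroot : ∀ᵐ ν ∂P, ∃ S' : Set (EuclideanSpace ℝ (Fin 3)),
      ν = (Measure.count : Measure (EuclideanSpace ℝ (Fin 3))).restrict S' ∧ SetGood S' 0 := by
    filter_upwards [hcore', hall] with ν hhc hGR
    obtain ⟨S', -, hsep, rfl⟩ := hhc
    refine ⟨S', rfl, ?_⟩
    simp only [hGR_def, count_restrict_singleton_ne_zero_iff] at hGR
    have hev' : ∀ᶠ n in (atTop : Filter ℕ), _ := Eventually.of_forall hGR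
    have hfreq := hev'.frequently
    rw [frequently_or_distrib] at hfreq
    rcases hfreq with h | h
    · obtain ⟨a, ha₁, ha₂, A, f, hf, hd⟩ := exists_bijOn_limit hδ hsep (fun n => (hηpos n).le) hηlim h
      exact setGood_zero_of_bijOn (Or.inl rfl) ha₁ ha₂ hf hd
    · obtain ⟨a, ha₁, ha₂, A, f, hf, hd⟩ := exists_bijOn_limit hδ hsep (fun n => (hηpos n).le) hηlim h
      exact setGood_zero_of_bijOn (Or.inr rfl) ha₁ ha₂ hf hd
  -- Step 3: everything shows at the root
  have hlf : ∀ᵐ μ ∂P, ∀ n : ℕ, μ ((fun z : EuclideanSpace ℝ (Fin 3) => ⌊‖z‖⌋₊) ⁻¹' {n}) < ⊤ := by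
    filter_upwards [hcore'] with μ hμ n
    obtain ⟨S, -, hsep, rfl⟩ := hμ
    exact Summit.AtomisticToContinuum.Crystallization.Theorems.PalmUnimodularRigidity.count_restrict_floorNorm_preimage_lt_top
      hδ hsep n
  have hevery :=
    Summit.AtomisticToContinuum.Crystallization.Theorems.PalmUnimodularRigidity.ae_forall_map_sub_of_ae
      hstat hlf hroot
  filter_upwards [hcore', hevery] with μ hhc hev
  obtain ⟨S, -, -, rfl⟩ := hhc
  refine ⟨S, rfl, fun y hy => ?_⟩
  obtain ⟨S', hS', hgood⟩ := hev y ((count_restrict_singleton_ne_zero_iff S y).2 hy)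
  rw [map_sub_count_restrict] at hS'
  rw [← eq_of_count_restrict_eq hS'] at hgood
  exact setGood_of_setGood_image_sub hgood

end Summit.AtomisticToContinuum.Crystallization.Theorems.PalmGoodLaw

end
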